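import Summits.BirchSwinnertonDyer.BirchSwinnertonDyer.Theorems.GoldfeldAllTwistsTwoConverseTwinAdditiveTwoAdicPlusPFive
import HarnessLib

set_option linter.dupNamespace false -- namespace `…BirchSwinnertonDyer.BirchSwinnertonDyer…` is the cell's (D-0017 nested layout)
set_option autoImplicit false

/-!
# B5⁺ tranche F_β⁺, file Fβ⁺-0a: `…TwinAdditiveTwoAdicPlusPFiveEven` — the `2`-adic kills of the EVEN `p`-classes `2p, 14p ∈ S(−42qp, 448q²p²)` on
# `(q, p) ≡ (7, 5) (mod 8)` (TYPE-FREE, `(p/q)`-free)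

Cell `bsd-goldfeld`, seat `bsd-goldfeld-s1p-c3x` (gen 16); planner ORDER (cccxciii) «OBJECT B5⁺», tranche F_β⁺ (GO implied by the uniform kill table,
STATUS KILL-TABLE line; seat files `scoping/kills_b75_plus.txt`: on b75+ the classes `2p, 14p` of `S(W)` die ONLY at `2`, the classes `p, 7p` at `2` and
at `p`). Companion of D⁺-0′ `…TwinAdditiveTwoAdicPlusPFive` (which kills `p, 7p` at `2` and `2p, 14p` at `p` by the type-α key): here `2p, 14p` die
at `2` with NO type condition, so the `(7, 5, +)` Selmer file of `W = 49a1^{(−2qp)}` becomes type-free. `--supports stmt-BirchSwinnertonDyer-19140` as a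
HELPER. Theses-free; theorems only; no definition, no fact binder, no `sorry`. FRONTIER-grade: a twist-density-ZERO sub-family; never distance-to-summit.

* §1 Two numeric kills: `w² = 10u⁴ + 210u²z² + 1120z⁴` and `w² = 70u⁴ + 210u²z² + 160z⁴` have no non-trivial `ℚ₂`-point — keys modulo `16`
  (`decide`); the deep charts halve twice (`1120 → 280 → 70`, `160 → 40 → 10`, engine `padicInt_two_sq_ne_of_descend`) and land on the other
  quartic's shallow chart.
* §2 The rescaled class kills on `(q, p) ≡ (7, 5) (mod 8)`: classes `2p, 14p` of `S(−42qp, 448q²p²)` (`p ↦ 5` by `isSoluble_two_of_common_factor`,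
  `q ↦ −1` by `isSoluble_two_of_sq_factor`, exactly as D⁺-0′ §2).
HONEST FRAMING: local lemmas only; no Selmer group is bounded in this file; items 19140 / 19350 / 20044 unchanged; BSD is not proved by any of this.

References: [SilvermanAEC2009] Prop. X.4.9, Example X.4.10; [Serre1973] Ch. II §3.3 Thm 4.
-/

noncomputable section

open scoped Classical

open WeierstrassCurve Literature.NumberTheory.EllipticCurves

namespace Summit.BirchSwinnertonDyer.BirchSwinnertonDyer.Theorems.GoldfeldGoodTwists

/-! ## §1 Two numeric `ℚ₂`-kills (all keys modulo `16`) -/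

section NumericPFiveEven

/-- `ℤ/16` keys, shallow charts: `S² ≠ 10 + 210T² + 1120T⁴` and `S² ≠ 70 + 210T² + 160T⁴`. [folklore] -/
theorem keys_shallow_plusPFiveEven :
    (∀ T S : ZMod (2 ^ 4), S ^ 2 ≠ ((10 : ℤ) : ZMod (2 ^ 4)) + ((210 : ℤ) : ZMod (2 ^ 4)) * T ^ 2 + ((1120 : ℤ) : ZMod (2 ^ 4)) * T ^ 4) ∧
    (∀ T S : ZMod (2 ^ 4), S ^ 2 ≠ ((70 : ℤ) : ZMod (2 ^ 4)) + ((210 : ℤ) : ZMod (2 ^ 4)) * T ^ 2 + ((160 : ℤ) : ZMod (2 ^ 4)) * T ^ 4) := by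
  refine ⟨?_, ?_⟩ <;> decide

/-- `ℤ/16` odd-`T` keys for the deep charts of `(210; 10, 1120)`: `1120, 280 + 210(2T+1)² + (10, 40)(2T+1)⁴` are never squares. [folklore] -/
theorem keys_deep_ten_plusPFiveEven :
    (∀ T S : ZMod (2 ^ 4), S ^ 2 ≠ ((1120 : ℤ) : ZMod (2 ^ 4)) + ((210 : ℤ) : ZMod (2 ^ 4)) * (2 * T + 1) ^ 2 +
      ((10 : ℤ) : ZMod (2 ^ 4)) * (2 * T + 1) ^ 4) ∧
    (∀ T S : ZMod (2 ^ 4), S ^ 2 ≠ ((280 : ℤ) : ZMod (2 ^ 4)) + ((210 : ℤ) : ZMod (2 ^ 4)) * (2 * T + 1) ^ 2 +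
      ((4 * 10 : ℤ) : ZMod (2 ^ 4)) * (2 * T + 1) ^ 4) := by
  refine ⟨?_, ?_⟩ <;> decide

/-- `ℤ/16` odd-`T` keys for the deep charts of `(210; 70, 160)`: `160, 40 + 210(2T+1)² + (70, 280)(2T+1)⁴` are never squares. [folklore] -/
theorem keys_deep_seventy_plusPFiveEven :
    (∀ T S : ZMod (2 ^ 4), S ^ 2 ≠ ((160 : ℤ) : ZMod (2 ^ 4)) + ((210 : ℤ) : ZMod (2 ^ 4)) * (2 * T + 1) ^ 2 +
      ((70 : ℤ) : ZMod (2 ^ 4)) * (2 * T + 1) ^ 4) ∧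
    (∀ T S : ZMod (2 ^ 4), S ^ 2 ≠ ((40 : ℤ) : ZMod (2 ^ 4)) + ((210 : ℤ) : ZMod (2 ^ 4)) * (2 * T + 1) ^ 2 +
      ((4 * 70 : ℤ) : ZMod (2 ^ 4)) * (2 * T + 1) ^ 4) := by
  refine ⟨?_, ?_⟩ <;> decide

/-- Shallow chart of `(210; 10, 1120)`: `s² ≠ 10 + 210t² + 1120t⁴` in `ℤ₂`. [folklore] -/
theorem chart_ten_plusPFiveEven (t s : ℤ_[2]) :
    s ^ 2 ≠ ((10 : ℤ) : ℤ_[2]) + ((210 : ℤ) : ℤ_[2]) * t ^ 2 + ((1120 : ℤ) : ℤ_[2]) * t ^ 4 :=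
  padicInt_two_sq_ne_of_zmodPow 4 keys_shallow_plusPFiveEven.1 t s

/-- Shallow chart of `(210; 70, 160)`: `s² ≠ 70 + 210t² + 160t⁴` in `ℤ₂`. [folklore] -/
theorem chart_seventy_plusPFiveEven (t s : ℤ_[2]) :
    s ^ 2 ≠ ((70 : ℤ) : ℤ_[2]) + ((210 : ℤ) : ℤ_[2]) * t ^ 2 + ((160 : ℤ) : ℤ_[2]) * t ^ 4 :=
  padicInt_two_sq_ne_of_zmodPow 4 keys_shallow_plusPFiveEven.2 t s

/-- **`w² = 10u⁴ + 210u²z² + 1120z⁴` has no non-trivial `ℚ₂`-point** (shallow chart mod `16`; deep chart: `u` odd dies mod `16`, `u` even halves twice,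
`1120 → 280 → 70`, landing on the shallow chart of `(210; 70, 160)`). [cite: SilvermanAEC2009, Prop. X.4.9 and Example X.4.10] -/
theorem not_isSoluble_two_numeric_ten_plusPFiveEven : ¬ ((twoIsogenyQuartic 210 10 1120).map (Int.castRingHom ℚ_[2])).IsSoluble := by
  obtain ⟨k1, k2⟩ := keys_deep_ten_plusPFiveEven
  refine not_isSoluble_two_of_padicInt_charts chart_ten_plusPFiveEven ?_
  refine padicInt_two_sq_ne_of_descend 280 4 (by norm_num) k1 ?_
  refine padicInt_two_sq_ne_of_descend 70 4 (by norm_num) k2 ?_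
  intro t s; push_cast
  have h := chart_seventy_plusPFiveEven t s
  push_cast at h
  convert h using 2

/-- **`w² = 70u⁴ + 210u²z² + 160z⁴` has no non-trivial `ℚ₂`-point** (shallow chart mod `16`; deep chart halves `160 → 40 → 10`, landing on the shallow
chart of `(210; 10, 1120)`). [cite: SilvermanAEC2009, Prop. X.4.9 and Example X.4.10] -/
theorem not_isSoluble_two_numeric_seventy_plusPFiveEven : ¬ ((twoIsogenyQuartic 210 70 160).map (Int.castRingHom ℚ_[2])).IsSoluble := by
  obtain ⟨k1, k2⟩ := keys_deep_seventy_plusPFiveEven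
  refine not_isSoluble_two_of_padicInt_charts chart_seventy_plusPFiveEven ?_
  refine padicInt_two_sq_ne_of_descend 40 4 (by norm_num) k1 ?_
  refine padicInt_two_sq_ne_of_descend 10 4 (by norm_num) k2 ?_
  intro t s; push_cast
  have h := chart_ten_plusPFiveEven t s
  push_cast at h
  convert h using 2

end NumericPFiveEven

/-! ## §2 The class kills `2p, 14p ∈ S(−42qp, 448q²p²)` at `2` on `(q, p) ≡ (7, 5) (mod 8)` -/

section ClassesPFiveEven
variable {q p : ℕ}

/-- **Class `2p ∈ S(−42qp, 448q²p²)` dies at `2`** (`q ≡ 7 (8)`, `p ≡ 5 (8)`; no type condition): `p ↦ 5` (common factor, `5p ≡ 1 (8)`), `q ↦ −1`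
(square factor) give §1's numeric `(210; 10, 1120)`. [cite: SilvermanAEC2009, Prop. X.4.9 and Example X.4.10] [cite: Serre1973, Ch. II §3.3 Thm 4] -/
theorem not_isSoluble_two_class_twoP_plusPFive (hq8 : q % 8 = 7) (hp8 : p % 8 = 5) {a d d' : ℤ} (ha : a = -42 * ((q : ℤ) * p))
    (hd : d = (p : ℤ) * 2) (hd' : d' = (p : ℤ) * (224 * (q : ℤ) ^ 2)) : ¬ ((twoIsogenyQuartic a d d').map (Int.castRingHom ℚ_[2])).IsSoluble :=
  fun h ↦ by
  have h1 := isSoluble_two_of_common_factor (n := p) (n₀ := 5) (by omega) (a₀ := -42 * (q : ℤ)) (d₀ := 2) (e₀ := 224 * (q : ℤ) ^ 2)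
    (by rw [ha]; ring) (by rw [hd]) (by rw [hd']) h
  have h2 := isSoluble_two_of_sq_factor (n := q) (n₀ := -1) (by omega) (a₁ := 5 * (-42)) (d := 5 * 2) (e₁ := 5 * 224)
    (by ring) (by ring) h1
  norm_num at h2
  exact not_isSoluble_two_numeric_ten_plusPFiveEven h2

/-- **Class `14p ∈ S(−42qp, 448q²p²)` dies at `2`** (`q ≡ 7 (8)`, `p ≡ 5 (8)`; no type condition): rescaled to §1's numeric `(210; 70, 160)`.
[cite: SilvermanAEC2009, Prop. X.4.9 and Example X.4.10] [cite: Serre1973, Ch. II §3.3 Thm 4] -/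
theorem not_isSoluble_two_class_fourteenP_plusPFive (hq8 : q % 8 = 7) (hp8 : p % 8 = 5) {a d d' : ℤ} (ha : a = -42 * ((q : ℤ) * p))
    (hd : d = (p : ℤ) * 14) (hd' : d' = (p : ℤ) * (32 * (q : ℤ) ^ 2)) : ¬ ((twoIsogenyQuartic a d d').map (Int.castRingHom ℚ_[2])).IsSoluble :=
  fun h ↦ by
  have h1 := isSoluble_two_of_common_factor (n := p) (n₀ := 5) (by omega) (a₀ := -42 * (q : ℤ)) (d₀ := 14) (e₀ := 32 * (q : ℤ) ^ 2)
    (by rw [ha]; ring) (by rw [hd]) (by rw [hd']) h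
  have h2 := isSoluble_two_of_sq_factor (n := q) (n₀ := -1) (by omega) (a₁ := 5 * (-42)) (d := 5 * 14) (e₁ := 5 * 32)
    (by ring) (by ring) h1
  norm_num at h2
  exact not_isSoluble_two_numeric_seventy_plusPFiveEven h2

end ClassesPFiveEven

end Summit.BirchSwinnertonDyer.BirchSwinnertonDyer.Theorems.GoldfeldGoodTwists

end
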